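import Summits.QuantumFields.YangMills.Theorems.LuscherReductionTwistedTraceScalingBTColourInvariance
import HarnessLib

/-!
# `fpBOKernel` as ONE integral over the product of the two fibres and the gauge group
# (lane A of S-BASE, crux `TwistedTraceScaling` stmt-QuantumFields-20203, C4-CORE, the (B-T) pen; design note `pub/ym-fleet/ym-luscher-20007-p1/COARSE-DESIGN.md` §25.8)

Bookkeeping for the (L3)/(L2) integrations: the iterated integral `fpBOKernel β Ω W u u' = ∫_v Ω(v) ∫_{v'} (∫_g W(g) K_β(orthoTube u v, (orthoTube u' v')^g) dg) Ω(v') dπ dπ` is one Bochner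
integral over `P = V × (V × G)` (`V = Edge → ℝ³` with `π = orthoTransverse`, `G = Site → SU(2)` with Haar), so that pointwise-in-`(v,v',g)` sandwiches (`…BTDiagonalAverage`) integrate by
monotonicity and one Fubini.
* `fpTriple β Ω W u u' p = Ω(v)·(W(g)·K_β(orthoTube u v, (orthoTube u' v')^g)·Ω(v'))`, `measurable_fpTriple`, `abs_fpTriple_le`;
* ★★ `fpBOKernel_eq_integral_prod` — `fpBOKernel β Ω W u u' = ∫ p, fpTriple β Ω W u u' p ∂(π.prod (π.prod gaugeMeasure))`.
HONEST FRAMING: measure bookkeeping for a stub of a child of the CONDITIONAL reduction route R2b1; the Laplace core of (B-T) is OPEN; C4-CORE OPEN; not infinite volume, not a gap, not Clay.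
-/

set_option autoImplicit false

noncomputable section

open MeasureTheory Filter Topology Real
open scoped BigOperators
open Literature.MathematicalPhysics.QuantumFieldTheory
open Literature.MathematicalPhysics.QuantumLattice

namespace Summit.QuantumFields.YangMills.Theorems.FemtoTransferGap.TwoLattice.ConstTube

open Summit.QuantumFields.YangMills.Theorems.FemtoTransferGap
open Summit.QuantumFields.YangMills.Theorems.FemtoTransferGap.TwoLattice.Avg
open Summit.QuantumFields.YangMills.Theorems.FemtoTransferGap.TwoLattice.Stiff (LinkSpace)

variable (L : ℕ) [NeZero L]

/-- **The integrand of `fpBOKernel` on the product space** `V × (V × G)`. [folklore] -/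
def fpTriple (β : ℝ) (Ω : LinkSpace L → ℝ) (W : (Site 3 L → SU2) → ℝ) (u u' : GaugeConfig 3 1 SU2)
    (p : (Edge 3 L → Fin 3 → ℝ) × ((Edge 3 L → Fin 3 → ℝ) × (Site 3 L → SU2))) : ℝ :=
  Ω (linkEmbed L p.1) * ((W p.2.2 * transferKernel su2Rep β (orthoTube L u p.1) (gaugeTransform p.2.2 (orthoTube L u' p.2.1))) * Ω (linkEmbed L p.2.1))

variable {L}

/-- The product integrand is measurable. [folklore] -/
theorem measurable_fpTriple (β : ℝ) {Ω : LinkSpace L → ℝ} (hΩ : Measurable Ω) {W : (Site 3 L → SU2) → ℝ} (hW : Measurable W) (u u' : GaugeConfig 3 1 SU2) :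
    Measurable (fpTriple L β Ω W u u') := by
  haveI : SecondCountableTopology SU2 := secondCountableTopology_su2
  have hK : Measurable fun q : GaugeConfig 3 L SU2 × GaugeConfig 3 L SU2 => transferKernel su2Rep β q.1 q.2 :=
    (continuous_transferKernel su2Rep continuous_su2Rep β).measurable
  have h1 : Measurable fun p : (Edge 3 L → Fin 3 → ℝ) × ((Edge 3 L → Fin 3 → ℝ) × (Site 3 L → SU2)) => orthoTube L u p.1 :=
    (measurable_orthoTube_right (L := L) u).comp measurable_fst
  have h2 : Measurable fun p : (Edge 3 L → Fin 3 → ℝ) × ((Edge 3 L → Fin 3 → ℝ) × (Site 3 L → SU2)) => gaugeTransform p.2.2 (orthoTube L u' p.2.1) := by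
    have ha : Measurable fun p : (Edge 3 L → Fin 3 → ℝ) × ((Edge 3 L → Fin 3 → ℝ) × (Site 3 L → SU2)) => (orthoTube L u' p.2.1, p.2.2) :=
      ((measurable_orthoTube_right (L := L) u').comp (measurable_fst.comp measurable_snd)).prodMk (measurable_snd.comp measurable_snd)
    have h := (measurable_gaugeAction (L := L)).comp ha
    simpa only [Function.comp_def] using h
  have hK' : Measurable fun p : (Edge 3 L → Fin 3 → ℝ) × ((Edge 3 L → Fin 3 → ℝ) × (Site 3 L → SU2)) =>
      transferKernel su2Rep β (orthoTube L u p.1) (gaugeTransform p.2.2 (orthoTube L u' p.2.1)) := by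
    have h := hK.comp (h1.prodMk h2); simpa only [Function.comp_def] using h
  unfold fpTriple
  exact (hΩ.comp ((measurable_linkEmbed L).comp measurable_fst)).mul
    (((hW.comp (measurable_snd.comp measurable_snd)).mul hK').mul (hΩ.comp ((measurable_linkEmbed L).comp (measurable_fst.comp measurable_snd))))

/-- The product integrand is bounded. [folklore] -/
theorem abs_fpTriple_le (β : ℝ) {Ω : LinkSpace L → ℝ} {CΩ : ℝ} (hCΩ : ∀ x, |Ω x| ≤ CΩ) {W : (Site 3 L → SU2) → ℝ} {CW : ℝ} (hCW : ∀ g, |W g| ≤ CW)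
    (u u' : GaugeConfig 3 1 SU2) : ∃ B : ℝ, ∀ p, |fpTriple L β Ω W u u' p| ≤ B := by
  obtain ⟨M, hM⟩ := exists_transferKernel_le su2Rep continuous_su2Rep β (L := L)
  have hCΩ0 : 0 ≤ CΩ := (abs_nonneg _).trans (hCΩ 0)
  have hCW0 : 0 ≤ CW := (abs_nonneg _).trans (hCW 1)
  have hM0 : 0 ≤ M := (transferKernel_pos su2Rep β (1 : GaugeConfig 3 L SU2) 1).le.trans (hM 1 1)
  refine ⟨CΩ * ((CW * M) * CΩ), fun p => ?_⟩
  unfold fpTriple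
  rw [abs_mul, abs_mul, abs_mul, abs_of_pos (transferKernel_pos su2Rep β _ _)]
  exact mul_le_mul (hCΩ _) (mul_le_mul (mul_le_mul (hCW _) (hM _ _) (transferKernel_pos su2Rep β _ _).le hCW0) (hCΩ _) (abs_nonneg _) (mul_nonneg hCW0 hM0))
    (mul_nonneg (mul_nonneg (abs_nonneg _) (transferKernel_pos su2Rep β _ _).le) (abs_nonneg _)) hCΩ0

/-- ★★ **`fpBOKernel` is one integral over `V × (V × G)`.** [folklore] -/
theorem fpBOKernel_eq_integral_prod (β : ℝ) {Ω : LinkSpace L → ℝ} (hΩ : Measurable Ω) {CΩ : ℝ} (hCΩ : ∀ x, |Ω x| ≤ CΩ) {W : (Site 3 L → SU2) → ℝ}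
    (hW : Measurable W) {CW : ℝ} (hCW : ∀ g, |W g| ≤ CW) (u u' : GaugeConfig 3 1 SU2) :
    fpBOKernel L β Ω W u u' = ∫ p, fpTriple L β Ω W u u' p ∂((orthoTransverse L).prod ((orthoTransverse L).prod (gaugeMeasure L))) := by
  haveI := isFiniteMeasure_orthoTransverse L
  obtain ⟨B, hB⟩ := abs_fpTriple_le (L := L) β hCΩ hCW u u'
  have hint : Integrable (fpTriple L β Ω W u u') ((orthoTransverse L).prod ((orthoTransverse L).prod (gaugeMeasure L))) :=
    integrable_of_measurable_abs_le _ (measurable_fpTriple β hΩ hW u u') hB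
  rw [integral_prod _ hint]
  unfold fpBOKernel
  refine integral_congr_ae (ae_of_all _ fun v => ?_)
  dsimp only
  -- inner: `∫_{(v',g)} = ∫_{v'} ∫_g`
  have hint2 : Integrable (fun q : (Edge 3 L → Fin 3 → ℝ) × (Site 3 L → SU2) => fpTriple L β Ω W u u' (v, q)) ((orthoTransverse L).prod (gaugeMeasure L)) :=
    integrable_of_measurable_abs_le _ ((measurable_fpTriple β hΩ hW u u').comp (measurable_const.prodMk measurable_id)) fun q => hB _
  rw [integral_prod _ hint2]
  unfold fpTriple
  dsimp only
  rw [← integral_const_mul]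
  refine integral_congr_ae (ae_of_all _ fun v' => ?_)
  dsimp only
  rw [← integral_mul_const, ← integral_const_mul]

end Summit.QuantumFields.YangMills.Theorems.FemtoTransferGap.TwoLattice.ConstTube

end
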